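/-
Copyright: lit-balaban Phase-2 proof seat p30 (gen 9).  Statement-level skeleton of a published paper; no proof claims beyond what
the kernel checks below.
-/
import Literature.MathematicalPhysics.QuantumFieldTheory.BalabanImbrieJaffe1984to88.BIJ85Prop12TorusBridgeGeom
import Literature.MathematicalPhysics.QuantumFieldTheory.Balaban1983to89.B5SettingP12Real

/-!
# [BalabanImbrieJaffe1985] (7.2.2) ⇐ [6I] Prop. 1.2 — kernels and partition-of-unity PIECES along `EK` (file 2 of 5)

T. Bałaban, J. Imbrie, A. Jaffe, Commun. Math. Phys. **97** (1985) 299–329 [BalabanImbrieJaffe1985], Sect. 7.2 p. 325; T. Bałaban,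
Commun. Math. Phys. **95** (1984) 17–40 [Balaban1984PropagatorsI] = [6I], Prop. 1.2 (1.108)–(1.111) p. 35 and the partition (1.118) p. 36.

Continuation of `BIJ85Prop12TorusBridgeGeom` (the knitting item «[6I] Prop. 1.2 for p09's torus carrier from r02's family of record»):
* §1 the kernels: `EK (x + e_μ) = EK x + e_μ` (`EK_shift`); the real/complex transports `trR`, `trC` of a fine vector field of `Setup`;
  `(G_kJ)_μ(x) = Re (Δ_a⁻¹J^ℂ)_μ(EK x)` (`Gk_mulVec_re` — p09's `Gk hk a` is by definition the real part of r02's `(DeltaA (L^k) Mk a)⁻¹`)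
  and `(∇G_kJ)_{λμ}(x) = Re (∇_λ(Δ_a⁻¹J^ℂ))_μ(EK x)` for r02's `B5Prop11Lattice.grad` (`DGk_mulVec_re`);
* §2 the PIECES of a source / cut-off along r02's printed partition of unity `B5CoverP12Lattice.wP` ((1.118): `Σ_{y′} wP y′ = 1`,
  `supp wP y′ ⊂ Δ̃(y′)`, unit-scale Lipschitz `Lw(d)`): `pieceJ`, `pieceZ`, `trZ`, sums, supports, sizes, the Lipschitz transfer
  `abs_pieceZ_sub_le`, and the bookkeeping used by the transfer files (`abs_sum_ball_le`: a sum over unit sites vanishing outside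
  `|y − y₀|_∞ ≤ r` is `≤ (2r+2)^d·max`; pieces of a source in p09's cube `Δ̃′(y_J)` vanish unless `|y″ − y_J|_∞ ≤ 2`).
WHAT IS PROVED (0 `sorry`; five bookkeeping `def`s with bodies: `trR`, `trC`, `pieceJ`, `pieceZ`, `trZ`).  statement-level skeleton of published theorems with citation tags; proofs where landed; nothing here is a claim about the Yang–Mills mass gap.
Unit `lit-balaban-p30` (literature-prover-lit-balaban-p30-g9-0), 2026-08-21.
-/

open scoped BigOperators Matrix

namespace Literature.MathematicalPhysics.QuantumFieldTheory.BalabanImbrieJaffe1984to88.BIJ85Prop12TorusBridgePieces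

open Balaban1983to89 hiding Site Plaq
open Balaban1983to89.LatticeFieldCalculus (supDist)
open Balaban1983to89.B3TorusRadialSums (supDist_comm)
open Balaban1983to89.B5Eq118OneStroke (iterBlockOf val_iterBlockOf)
open Balaban1983to89.B5Eq117TorusCarriers (Mk EK EK_apply EK_natCast)
open Balaban1983to89.B5Prop11Plancherel (Tor fine unitVec)
open Balaban1983to89.B5Prop12FieldsLattice (cdistF distU distSite toFine cubeT cubeB suppInL supNormL cutInL)
open Balaban1983to89.B5CoverP12Lattice (wP sum_wP mem_cubeT_of_wP_ne_zero wP_nonneg wP_le_one abs_wP_sub_le Lw Lw_nonneg)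
open Balaban1983to89.B5DeltaA169 (DeltaA)
open Balaban1983to89.LatticeNorms (supNorm supNorm_le norm_le_supNorm supNorm_nonneg)
open BIJ85Ineq722Torus BIJ85Ineq722DeltaA BIJ85Prop12TorusBridgeGeom
-- inside this namespace the bare `Site` is the `ℤ^d` carrier of the QFT root; the torus one is renamed:
open Balaban1983to89 renaming Site → TSite

noncomputable section

variable {P : Params} {k : ℕ}

/-! ## §1  `EK` and the kernels `G_k`, `∇G_k` -/

/-- **`EK (x + e_μ) = EK x + e_μ`** (bonds go to bonds). [cite: Balaban1984PropagatorsI, (1.1) p.18] -/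
theorem EK_shift (hk : k ≤ P.m + P.K) (x : TSite P 0) (μ : Fin P.d) :
    EK hk (x.shift μ) = EK hk x + unitVec (fine (P.L ^ k) (Mk P k)) μ := by
  funext ν
  rw [EK_apply, Pi.add_apply, EK_apply, unitVec]
  by_cases hν : ν = μ
  · subst hν
    rw [Balaban1983to89.Site.shift, Function.update_self, Pi.single_eq_same, map_add, map_one]
  · rw [Balaban1983to89.Site.shift, Function.update_of_ne hν, Pi.single_eq_of_ne hν, add_zero]

/-- the real transport of a real fine vector field along `EK`: `J^(EK x, μ) = J(x, μ)` (r02's real sources `LocR.vec`).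
[cite: Balaban1984PropagatorsI, (1.108) p.35] -/
def trR (hk : k ≤ P.m + P.K) (J : TSite P 0 × Fin P.d → ℝ) : Tor (fine (P.L ^ k) (Mk P k)) × Fin P.d → ℝ :=
  fun b => J ((EK hk).symm b.1, b.2)

/-- unfolding. [cite: Balaban1984PropagatorsI, (1.108) p.35] -/
@[simp] theorem trR_apply (hk : k ≤ P.m + P.K) (J : TSite P 0 × Fin P.d → ℝ) (b : Tor (fine (P.L ^ k) (Mk P k)) × Fin P.d) :
    trR hk J b = J ((EK hk).symm b.1, b.2) := rfl

/-- the complex transport (r02's embedding `LocR.emb` of the real source `trR`): `J^ℂ(EK x, μ) = J(x, μ)`.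
[cite: Balaban1984PropagatorsI, (1.108) p.35] -/
def trC (hk : k ≤ P.m + P.K) (J : TSite P 0 × Fin P.d → ℝ) : Tor (fine (P.L ^ k) (Mk P k)) × Fin P.d → ℂ :=
  fun b => (trR hk J b : ℂ)

/-- unfolding. [cite: Balaban1984PropagatorsI, (1.108) p.35] -/
@[simp] theorem trC_apply (hk : k ≤ P.m + P.K) (J : TSite P 0 × Fin P.d → ℝ) (b : Tor (fine (P.L ^ k) (Mk P k)) × Fin P.d) :
    trC hk J b = (J ((EK hk).symm b.1, b.2) : ℂ) := rfl

/-- `J^ℂ` is the embedded real transport, definitionally. [cite: Balaban1984PropagatorsI, (1.108) p.35] -/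
theorem trC_eq (hk : k ≤ P.m + P.K) (J : TSite P 0 × Fin P.d → ℝ) : trC hk J = fun b => (trR hk J b : ℂ) := rfl

/-- `J^ℂ` at a transported index. [cite: Balaban1984PropagatorsI, (1.108) p.35] -/
theorem trC_apply_EK (hk : k ≤ P.m + P.K) (J : TSite P 0 × Fin P.d → ℝ) (x : TSite P 0) (μ : Fin P.d) :
    trC hk J (EK hk x, μ) = (J (x, μ) : ℂ) := by
  rw [trC_apply, Equiv.symm_apply_apply]

/-- `J^ℂ` is additive. [cite: Balaban1984PropagatorsI, (1.108) p.35] -/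
theorem trC_add (hk : k ≤ P.m + P.K) (J J' : TSite P 0 × Fin P.d → ℝ) : trC hk (J + J') = trC hk J + trC hk J' := by
  funext b; simp [trC]

/-- `J^ℂ` of a finite sum. [cite: Balaban1984PropagatorsI, (1.108) p.35] -/
theorem trC_sum (hk : k ≤ P.m + P.K) {ι : Type*} (s : Finset ι) (J : ι → TSite P 0 × Fin P.d → ℝ) :
    trC hk (∑ i ∈ s, J i) = ∑ i ∈ s, trC hk (J i) := by
  funext b; simp [trC, Finset.sum_apply]

/-- `‖J^ℂ(b)‖ = |J(·)|`. [cite: Balaban1984PropagatorsI, (1.108) p.35] -/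
theorem norm_trC (hk : k ≤ P.m + P.K) (J : TSite P 0 × Fin P.d → ℝ) (b : Tor (fine (P.L ^ k) (Mk P k)) × Fin P.d) :
    ‖trC hk J b‖ = |J ((EK hk).symm b.1, b.2)| := by
  rw [trC_apply, Complex.norm_real, Real.norm_eq_abs]

/-- **`(G_kJ)_μ(x) = Re (Δ_a⁻¹J^ℂ)(EK x, μ)`** — p09's kernel `Gk hk a` is the real part of r02's `(DeltaA (L^k) Mk a)⁻¹` read through `EK`
(its definition), so the two `GJ` agree on real sources. [cite: Balaban1984PropagatorsI, (1.71) p.30] -/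
theorem Gk_mulVec_re (hk : k ≤ P.m + P.K) (a : ℝ) (J : TSite P 0 × Fin P.d → ℝ) (x : TSite P 0) (μ : Fin P.d) :
    (Gk hk a *ᵥ J) (x, μ) = (((DeltaA (P.L ^ k) (Mk P k) a)⁻¹ *ᵥ trC hk J) (EK hk x, μ)).re := by
  simp only [Matrix.mulVec, dotProduct, Complex.re_sum, trC_apply, Complex.mul_re, Complex.ofReal_re, Complex.ofReal_im,
    mul_zero, sub_zero]
  symm
  refine Fintype.sum_equiv ((EK hk).prodCongr (Equiv.refl (Fin P.d))).symm _ _ fun b => ?_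
  simp only [Equiv.prodCongr_symm, Equiv.refl_symm, Equiv.prodCongr_apply, Prod.map, Equiv.refl_apply, Gk,
    Equiv.apply_symm_apply]

/-- `(∇_λ G_kJ)_μ(x) = L^k((G_kJ)_μ(x + e_λ) − (G_kJ)_μ(x))`. [cite: Balaban1984PropagatorsI, (1.108) p.35] -/
theorem DGk_mulVec_eq (hk : k ≤ P.m + P.K) (a : ℝ) (J : TSite P 0 × Fin P.d → ℝ) (x : TSite P 0) (lam μ : Fin P.d) :
    (DGk hk a *ᵥ J) (x, lam, μ) = (P.L : ℝ) ^ k * ((Gk hk a *ᵥ J) (x.shift lam, μ) - (Gk hk a *ᵥ J) (x, μ)) := by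
  simp only [Matrix.mulVec, dotProduct, DGk, Finset.mul_sum, ← Finset.sum_sub_distrib]
  refine Finset.sum_congr rfl fun j _ => ?_
  ring

/-- r02's gradient componentwise: `(∇_ν A)_κ(z) = n(A_κ(z + e_ν) − A_κ(z))`. [cite: Balaban1984PropagatorsI, (1.31) p.23] -/
theorem grad_apply {d : ℕ} (n : ℕ) [NeZero n] (M : Fin d → ℕ) [∀ μ, NeZero (M μ)] (A : Tor (fine n M) × Fin d → ℂ)
    (ν : Fin d) (z : Tor (fine n M)) (κ : Fin d) :
    B5Prop11Lattice.grad n M A ν (z, κ) = (n : ℂ) * (A (z + unitVec (fine n M) ν, κ) - A (z, κ)) := by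
  rw [B5Prop11Lattice.grad, B5Action121.fdiff_mulVec_apply, B5Action121.sdiff_mulVec]
  rfl

/-- **`(∇G_kJ)_{λμ}(x) = Re (∇_λ(Δ_a⁻¹J^ℂ))_μ(EK x)`** — p09's gradient kernel `DGk` is the real part of r02's `B5Prop11Lattice.grad` of
`Δ_a⁻¹J^ℂ` read through `EK` (`EK_shift`). [cite: Balaban1984PropagatorsI, (1.108) p.35] -/
theorem DGk_mulVec_re (hk : k ≤ P.m + P.K) (a : ℝ) (J : TSite P 0 × Fin P.d → ℝ) (x : TSite P 0) (lam μ : Fin P.d) :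
    (DGk hk a *ᵥ J) (x, lam, μ) =
      (B5Prop11Lattice.grad (P.L ^ k) (Mk P k) ((DeltaA (P.L ^ k) (Mk P k) a)⁻¹ *ᵥ trC hk J) lam (EK hk x, μ)).re := by
  rw [DGk_mulVec_eq, grad_apply, ← EK_shift hk, Gk_mulVec_re, Gk_mulVec_re, Complex.mul_re, Complex.sub_re, Complex.sub_im,
    Complex.natCast_re, Complex.natCast_im, zero_mul, sub_zero]
  push_cast
  ring

/-! ## §2  Pieces along the printed partition of unity (1.118) -/

/-- the unit tori of `Setup` have at least two sites per direction. [cite: Balaban1987RG1, (0.1) p.251] -/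
theorem two_le_Mk (k : ℕ) (μ : Fin P.d) : 2 ≤ Mk P k μ := by
  show 2 ≤ 2 * P.L ^ (P.m + P.K - k)
  have := pow_pos P.L_pos (P.m + P.K - k)
  omega

/-- `1 ≤ L^k`. [cite: Balaban1987RG1, (0.1) p.251] -/
theorem one_le_pow_L (k : ℕ) : 1 ≤ P.L ^ k := Nat.one_le_pow _ _ P.L_pos

/-- **the piece of a fine vector field near the unit site `y″`**: `J_{y″}(x, μ) = wP y″ (EK x)·J(x, μ)` (r02's printed partition weights
(1.118), `B5CoverP12Lattice.wP`). [cite: Balaban1984PropagatorsI, (1.118) p.36] -/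
def pieceJ (hk : k ≤ P.m + P.K) (y'' : TSite P k) (J : TSite P 0 × Fin P.d → ℝ) : TSite P 0 × Fin P.d → ℝ :=
  fun i => wP (Mk P k) (P.L ^ k) y'' (EK hk i.1) * J i

/-- unfolding. [cite: Balaban1984PropagatorsI, (1.118) p.36] -/
@[simp] theorem pieceJ_apply (hk : k ≤ P.m + P.K) (y'' : TSite P k) (J : TSite P 0 × Fin P.d → ℝ) (i : TSite P 0 × Fin P.d) :
    pieceJ hk y'' J i = wP (Mk P k) (P.L ^ k) y'' (EK hk i.1) * J i := rfl

/-- **`Σ_{y″} J_{y″} = J`** (`Σ wP = 1`). [cite: Balaban1984PropagatorsI, (1.118) p.36] -/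
theorem sum_pieceJ (hk : k ≤ P.m + P.K) (J : TSite P 0 × Fin P.d → ℝ) : ∑ y'' : TSite P k, pieceJ hk y'' J = J := by
  funext i
  rw [Finset.sum_apply]
  simp only [pieceJ_apply]
  have hs : ∑ y'' : TSite P k, wP (Mk P k) (P.L ^ k) y'' (EK hk i.1) = 1 := sum_wP (Mk P k) (P.L ^ k) (two_le_Mk k) (EK hk i.1)
  rw [← Finset.sum_mul, hs, one_mul]

/-- the transport of a piece is the weight times the transport. [cite: Balaban1984PropagatorsI, (1.118) p.36] -/
theorem trC_pieceJ (hk : k ≤ P.m + P.K) (y'' : TSite P k) (J : TSite P 0 × Fin P.d → ℝ) (b : Tor (fine (P.L ^ k) (Mk P k)) × Fin P.d) :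
    trC hk (pieceJ hk y'' J) b = (wP (Mk P k) (P.L ^ k) y'' b.1 : ℂ) * trC hk J b := by
  simp only [trC_apply, pieceJ_apply, Equiv.apply_symm_apply, Complex.ofReal_mul]

/-- pieces are no larger than the field. [cite: Balaban1984PropagatorsI, (1.118) p.36] -/
theorem abs_pieceJ_le (hk : k ≤ P.m + P.K) (y'' : TSite P k) (J : TSite P 0 × Fin P.d → ℝ) (i : TSite P 0 × Fin P.d) :
    |pieceJ hk y'' J i| ≤ |J i| := by
  rw [pieceJ_apply, abs_mul, abs_of_nonneg (wP_nonneg _ _ _ _)]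
  exact mul_le_of_le_one_left (abs_nonneg _) (wP_le_one _ _ _ _)

/-- **support of a piece**: `J_{y″}(x, μ) ≠ 0 ⇒ EK x ∈ Δ̃(y″)` and `J(x, μ) ≠ 0`. [cite: Balaban1984PropagatorsI, (1.118) p.36] -/
theorem pieceJ_ne_zero (hk : k ≤ P.m + P.K) {y'' : TSite P k} {J : TSite P 0 × Fin P.d → ℝ} {i : TSite P 0 × Fin P.d}
    (h : pieceJ hk y'' J i ≠ 0) : EK hk i.1 ∈ cubeT (P.L ^ k) (Mk P k) y'' ∧ J i ≠ 0 := by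
  rw [pieceJ_apply] at h
  exact ⟨mem_cubeT_of_wP_ne_zero _ _ (one_le_pow_L k) (left_ne_zero_of_mul h), right_ne_zero_of_mul h⟩

/-- **the piece of a cut-off near the unit site `y′`**: `ζ_{y′}(x) = wP y′ (EK x)·ζ(x)`. [cite: Balaban1984PropagatorsI, (1.118) p.36] -/
def pieceZ (hk : k ≤ P.m + P.K) (y' : TSite P k) (ζ : TSite P 0 → ℝ) : TSite P 0 → ℝ :=
  fun x => wP (Mk P k) (P.L ^ k) y' (EK hk x) * ζ x

/-- unfolding. [cite: Balaban1984PropagatorsI, (1.118) p.36] -/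
@[simp] theorem pieceZ_apply (hk : k ≤ P.m + P.K) (y' : TSite P k) (ζ : TSite P 0 → ℝ) (x : TSite P 0) :
    pieceZ hk y' ζ x = wP (Mk P k) (P.L ^ k) y' (EK hk x) * ζ x := rfl

/-- **`Σ_{y′} ζ_{y′} = ζ`.** [cite: Balaban1984PropagatorsI, (1.118) p.36] -/
theorem sum_pieceZ (hk : k ≤ P.m + P.K) (ζ : TSite P 0 → ℝ) : ∑ y' : TSite P k, pieceZ hk y' ζ = ζ := by
  funext x
  rw [Finset.sum_apply]
  simp only [pieceZ_apply]
  have hs : ∑ y' : TSite P k, wP (Mk P k) (P.L ^ k) y' (EK hk x) = 1 := sum_wP (Mk P k) (P.L ^ k) (two_le_Mk k) (EK hk x)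
  rw [← Finset.sum_mul, hs, one_mul]

/-- pieces of a cut-off are no larger than the cut-off. [cite: Balaban1984PropagatorsI, (1.118) p.36] -/
theorem abs_pieceZ_le (hk : k ≤ P.m + P.K) (y' : TSite P k) (ζ : TSite P 0 → ℝ) (x : TSite P 0) :
    |pieceZ hk y' ζ x| ≤ |ζ x| := by
  rw [pieceZ_apply, abs_mul, abs_of_nonneg (wP_nonneg _ _ _ _)]
  exact mul_le_of_le_one_left (abs_nonneg _) (wP_le_one _ _ _ _)

/-- **support of a cut-off piece**: `ζ_{y′}(x) ≠ 0 ⇒ EK x ∈ Δ̃(y′)` and `ζ(x) ≠ 0`. [cite: Balaban1984PropagatorsI, (1.118) p.36] -/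
theorem pieceZ_ne_zero (hk : k ≤ P.m + P.K) {y' : TSite P k} {ζ : TSite P 0 → ℝ} {x : TSite P 0} (h : pieceZ hk y' ζ x ≠ 0) :
    EK hk x ∈ cubeT (P.L ^ k) (Mk P k) y' ∧ ζ x ≠ 0 := by
  rw [pieceZ_apply] at h
  exact ⟨mem_cubeT_of_wP_ne_zero _ _ (one_le_pow_L k) (left_ne_zero_of_mul h), right_ne_zero_of_mul h⟩

/-- **THE LIPSCHITZ TRANSFER**: `|ζ_{y′}(x) − ζ_{y′}(x′)| ≤ |ζ(x) − ζ(x′)| + Lw(d)·|x − x′|·|ζ(x′)|` (`|x − x′| = dS`, the unit-scale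
Lipschitz bound of the printed weights, `B5CoverP12Lattice.abs_wP_sub_le`). [cite: Balaban1984PropagatorsI, (1.118) p.36] -/
theorem abs_pieceZ_sub_le (hk : k ≤ P.m + P.K) (y' : TSite P k) (ζ : TSite P 0 → ℝ) (x x' : TSite P 0) :
    |pieceZ hk y' ζ x - pieceZ hk y' ζ x'| ≤
      |ζ x - ζ x'| + Lw P.d * distU (P.L ^ k) (Mk P k) (EK hk x) (EK hk x') * |ζ x'| := by
  rw [pieceZ_apply, pieceZ_apply]
  set w := wP (Mk P k) (P.L ^ k) y' (EK hk x)
  set w' := wP (Mk P k) (P.L ^ k) y' (EK hk x')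
  have hw0 : 0 ≤ w := wP_nonneg _ _ _ _
  have hw1 : w ≤ 1 := wP_le_one _ _ _ _
  have hL := abs_wP_sub_le (Mk P k) (P.L ^ k) (one_le_pow_L k) (two_le_Mk k) y' (EK hk x) (EK hk x')
  calc |w * ζ x - w' * ζ x'| = |w * (ζ x - ζ x') + (w - w') * ζ x'| := by ring_nf
    _ ≤ |w * (ζ x - ζ x')| + |(w - w') * ζ x'| := abs_add_le _ _
    _ = w * |ζ x - ζ x'| + |w - w'| * |ζ x'| := by rw [abs_mul, abs_mul, abs_of_nonneg hw0]
    _ ≤ 1 * |ζ x - ζ x'| + Lw P.d * distU (P.L ^ k) (Mk P k) (EK hk x) (EK hk x') * |ζ x'| := by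
        gcongr
    _ = _ := by rw [one_mul]

/-! ## §3  Bookkeeping for the transfer: few non-zero pieces; linearity; supports; the transported cut-off -/

/-- a sum over the unit torus whose terms vanish outside the ball `|y − y₀|_∞ ≤ r` and are `≤ B` inside is `≤ (2r+2)^d·B`.
[cite: Balaban1984PropagatorsI, (1.115) p.36] -/
theorem abs_sum_ball_le {j : ℕ} (t : TSite P j → ℝ) (y₀ : TSite P j) (r : ℕ) {B : ℝ} (hB : 0 ≤ B)
    (hzero : ∀ y, r < supDist y y₀ → t y = 0) (hle : ∀ y, supDist y y₀ ≤ r → |t y| ≤ B) :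
    |∑ y, t y| ≤ (2 * r + 2) ^ P.d * B := by
  classical
  have hsum : ∑ y, t y = ∑ y ∈ Finset.univ.filter (fun y : TSite P j => supDist y y₀ ≤ r), t y := by
    refine (Finset.sum_filter_of_ne fun y _ hne => ?_).symm
    by_contra hy
    exact hne (hzero y (not_le.mp hy))
  rw [hsum]
  calc |∑ y ∈ Finset.univ.filter (fun y : TSite P j => supDist y y₀ ≤ r), t y|
      ≤ ∑ y ∈ Finset.univ.filter (fun y : TSite P j => supDist y y₀ ≤ r), |t y| := Finset.abs_sum_le_sum_abs _ _
    _ ≤ ∑ _y ∈ Finset.univ.filter (fun y : TSite P j => supDist y y₀ ≤ r), B :=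
        Finset.sum_le_sum fun y hy => hle y (by rw [Finset.mem_filter] at hy; exact hy.2)
    _ = (Finset.univ.filter (fun y : TSite P j => supDist y y₀ ≤ r)).card * B := by rw [Finset.sum_const, nsmul_eq_mul]
    _ ≤ (2 * r + 2) ^ P.d * B := by
        apply mul_le_mul_of_nonneg_right _ hB
        exact_mod_cast card_ball_le y₀ r

/-- `M(Σ v_i) = Σ Mv_i`. [cite: Balaban1984PropagatorsI, (1.110) p.35] -/
theorem mulVec_finset_sum {m n ι : Type*} [Fintype n] (A : Matrix m n ℝ) (s : Finset ι) (v : ι → n → ℝ) :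
    A *ᵥ (∑ i ∈ s, v i) = ∑ i ∈ s, A *ᵥ v i := by
  have := map_sum (Matrix.mulVecLin A) v s
  simpa only [Matrix.mulVecLin_apply] using this

/-- the sup norm of the transported source is at most `|J|`. [cite: Balaban1984PropagatorsI, (1.108) p.35] -/
theorem supNormL_trC_le (hk : k ≤ P.m + P.K) (J : TSite P 0 × Fin P.d → ℝ) :
    supNormL (P.L ^ k) (Mk P k) (.vec (trC hk J)) ≤ ‖J‖ := by
  simp only [supNormL]
  refine supNorm_le (norm_nonneg _) fun b _ => ?_
  rw [norm_trC, ← Real.norm_eq_abs]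
  exact norm_le_pi_norm J _

/-- pieces have sup norm at most `|J|`. [cite: Balaban1984PropagatorsI, (1.118) p.36] -/
theorem norm_pieceJ_le (hk : k ≤ P.m + P.K) (y'' : TSite P k) (J : TSite P 0 × Fin P.d → ℝ) : ‖pieceJ hk y'' J‖ ≤ ‖J‖ := by
  rw [pi_norm_le_iff_of_nonneg (norm_nonneg _)]
  intro i
  rw [Real.norm_eq_abs]
  exact (abs_pieceJ_le hk y'' J i).trans (by rw [← Real.norm_eq_abs]; exact norm_le_pi_norm J i)

/-- the transported source of a piece is supported in `Δ̃(y″)`. [cite: Balaban1984PropagatorsI, (1.118) p.36] -/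
theorem suppInL_pieceJ (hk : k ≤ P.m + P.K) (y'' : TSite P k) (J : TSite P 0 × Fin P.d → ℝ) :
    suppInL (P.L ^ k) (Mk P k) (.vec (trC hk (pieceJ hk y'' J))) y'' := by
  simp only [suppInL]
  intro b hb
  rw [trC_apply, Complex.ofReal_ne_zero] at hb
  have h := (pieceJ_ne_zero hk hb).1
  rwa [Equiv.apply_symm_apply] at h

/-- a piece of a source supported in p09's cube `Δ̃′(y_J)` vanishes unless `|y″ − y_J|_∞ ≤ 2`. [cite: Balaban1984PropagatorsI, (1.118) p.36] -/
theorem pieceJ_eq_zero_of_far (hk : k ≤ P.m + P.K) {D : TorusData P k} {J : TSite P 0 × Fin P.d → ℝ} {yJ : TSite P k}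
    (hJ : ∀ i, J i ≠ 0 → i.1 ∈ (torusRep P k D).cube yJ) {y'' : TSite P k} (hfar : 2 < supDist y'' yJ) : pieceJ hk y'' J = 0 := by
  by_contra hne
  obtain ⟨i, hi⟩ := Function.ne_iff.mp hne
  obtain ⟨h1, h2⟩ := pieceJ_ne_zero hk hi
  have d1 := supDist_blk_le_of_mem_cubeT hk h1
  have d2 := supDist_blk_le_of_mem_cube hk (hJ i h2)
  have := supDist_triangle y'' (iterBlockOf k i.1) yJ
  rw [supDist_comm y'' (iterBlockOf k i.1)] at this
  omega

/-- a piece of a cut-off supported in p09's cube `Δ̃′(y)` vanishes unless `|y′ − y|_∞ ≤ 2`. [cite: Balaban1984PropagatorsI, (1.118) p.36] -/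
theorem pieceZ_eq_zero_of_far (hk : k ≤ P.m + P.K) {D : TorusData P k} {ζ : TSite P 0 → ℝ} {y : TSite P k}
    (hζ : ∀ x, ζ x ≠ 0 → x ∈ (torusRep P k D).cube y) {y' : TSite P k} (hfar : 2 < supDist y' y) : pieceZ hk y' ζ = 0 := by
  by_contra hne
  obtain ⟨x, hx⟩ := Function.ne_iff.mp hne
  obtain ⟨h1, h2⟩ := pieceZ_ne_zero hk hx
  have d1 := supDist_blk_le_of_mem_cubeT hk h1
  have d2 := supDist_blk_le_of_mem_cube hk (hζ x h2)
  have := supDist_triangle y' (iterBlockOf k x) y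
  rw [supDist_comm y' (iterBlockOf k x)] at this
  omega

/-- exponent bookkeeping: `|y − y_J| ≤ c + |u − v| ⟹ e^{−δ₀|u − v|} ≤ e^{cδ₀}e^{−δ₀|y − y_J|}` (`δ₀ ≥ 0`). [cite: Balaban1984PropagatorsI, (1.115) p.36] -/
theorem exp_le_of_triangle {δ₀ : ℝ} (hδ : 0 ≤ δ₀) {c duv dyJ : ℝ} (h : dyJ ≤ c + duv) :
    Real.exp (-(δ₀ * duv)) ≤ Real.exp (c * δ₀) * Real.exp (-(δ₀ * dyJ)) := by
  rw [← Real.exp_add]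
  apply Real.exp_le_exp.2
  nlinarith

/-- the transported piece of a cut-off: `ζ_{y′}^(z) = ζ_{y′}(EK⁻¹z)`. [cite: Balaban1984PropagatorsI, (1.118) p.36] -/
def trZ (hk : k ≤ P.m + P.K) (y' : TSite P k) (ζ : TSite P 0 → ℝ) : Tor (fine (P.L ^ k) (Mk P k)) → ℝ := fun z => pieceZ hk y' ζ ((EK hk).symm z)

/-- unfolding. [cite: Balaban1984PropagatorsI, (1.118) p.36] -/
@[simp] theorem trZ_apply (hk : k ≤ P.m + P.K) (y' : TSite P k) (ζ : TSite P 0 → ℝ) (z : Tor (fine (P.L ^ k) (Mk P k))) :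
    trZ hk y' ζ z = pieceZ hk y' ζ ((EK hk).symm z) := rfl

/-- the transported piece is supported in `Δ̃(y′)`. [cite: Balaban1984PropagatorsI, (1.118) p.36] -/
theorem cutInL_trZ (hk : k ≤ P.m + P.K) (y' : TSite P k) (ζ : TSite P 0 → ℝ) : cutInL (P.L ^ k) (Mk P k) (trZ hk y' ζ) y' := by
  intro z hz
  have h := (pieceZ_ne_zero hk hz).1
  rwa [Equiv.apply_symm_apply] at h

end

end Literature.MathematicalPhysics.QuantumFieldTheory.BalabanImbrieJaffe1984to88.BIJ85Prop12TorusBridgePieces
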